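import Mathlib
import Summits.ResolutionOfSingularities.ResolutionOfSingularities.Theorems.WildQuotientsWildQuotientResolutionTwoBlocksCentreStable
import Summits.ResolutionOfSingularities.ResolutionOfSingularities.Theorems.WildQuotientsWildQuotientResolutionJordanThreeChartsB
import Literature.AlgebraicGeometry.Resolution.AffineBlowupIntegral

/-!
# Programme V3U (toric exit for `J₃`, every `p`): the `σ`-stable centre `(x_a, x_b²)`, its blow-up, and the chart `D₊(x_b² t)`

(crux stmt-ResolutionOfSingularities-15640 `WildQuotients.WildQuotientResolution`, line `Sketch`,
sector `|G| = p`; programme V3U of res-L1-w45c-plan-1's RULING pre-CHAIN-v5 2026-08-27T01:38:23Z,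
row stub-2 «V3U-B»; [OURS · L1 W4.5c] — NOT a statement of any manuscript.)

For the `J₃` datum `σ x_a = x_a`, `σ x_b = x_b + x_a`, `σ x_c = x_c + x_b` (identity on the other
coordinates) the ideal `C = (x_a, x_b²)` — the `(2,1)`-weighted blow-up centre of the fixed locus,
`= (x_a, d₁)` with `d₁ = x_b² − x_a x_b − 2 x_a x_c` invariant — is `⟨σ⟩`-stable in EVERY
characteristic (`σ(x_b²) = x_b² + (2x_b + x_a)·x_a`). GENERATOR VECTOR OF RECORD (literal):
`(![X a, X b ^ 2] : Fin 2 → MvPolynomial (Fin n) k)`; chart `j = 0 = D₊(x_a t)` (the `A₁`-cone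
chart), chart `j = 1 = D₊(x_b² t)` (regular).

* `map_centre_le`, `map_centre_eq`, `smul_centre_pointwise`, `idealSheaf_centre_comap` — stability (pattern
  `JordanThree.map_k3_le` … `idealSheaf_k3_comap`, p482025): `idealSheaf_centre_comap` is VERBATIM the
  hypothesis `hρ` of `IsBlowup.liftAction` for `V = Bl_C 𝔸ⁿ` and any `ρ` with the affine-quotient law.
* `centre_blowup_integral_proper_birational` — `Bl_C 𝔸ⁿ` is integral, `Bl_C 𝔸ⁿ → 𝔸ⁿ` proper and
  birational (it is NOT regular: the chart `D₊(x_a t)` is the `A₁`-cone `x_b² = x_a r` times `𝔸ⁿ⁻²`).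
* `isRegularRing_chartRing_centre_b` — the chart `D₊(x_b² t)` IS regular: its ring is
  `k[x][C/x_b²] = k[x_b, v, (x_s)_{s≠a,b}]`, `v = x_a/x_b²` (the K₃-chart-B1 engine
  `JordanThree.isRegularRing_chartRing_of_chartData`, p482519, with exponent 2 instead of 6).
-/

-- single-problem summit: the doubled namespace component `ResolutionOfSingularities` is forced
set_option linter.dupNamespace false

noncomputable section

open CategoryTheory AlgebraicGeometry MvPolynomial IsLocalization
open scoped Pointwise
open Literature.AlgebraicGeometry.Resolution

namespace Summit.ResolutionOfSingularities.ResolutionOfSingularities.Theorems.WildQuotientResolution.ToricExit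

/-- **`τ(C) ⊆ C`**, `C = (x_a, x_b²)`, for every ring endomorphism `τ` of `k[x₁,…,xₙ]` with
`τ x_a = x_a`, `τ x_b = x_b + s·x_a` (`s` arbitrary; any characteristic):
`τ(x_b²) = x_b² + (2 s x_b + s² x_a)·x_a`. [folklore] -/
theorem map_centre_le (k : Type) [Field k] (n : ℕ) (a b : Fin n)
    (τ : MvPolynomial (Fin n) k →+* MvPolynomial (Fin n) k) (s : MvPolynomial (Fin n) k)
    (ha : τ (X a) = X a) (hb : τ (X b) = X b + s * X a) :
    Ideal.map τ (Ideal.span (Set.range (![X a, X b ^ 2] : Fin 2 → MvPolynomial (Fin n) k))) ≤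
      Ideal.span (Set.range (![X a, X b ^ 2] : Fin 2 → MvPolynomial (Fin n) k)) := by
  rw [Ideal.map_span, Ideal.span_le]
  rintro _ ⟨_, ⟨j, rfl⟩, rfl⟩
  rw [SetLike.mem_coe, Ideal.mem_span_range_iff_exists_fun]
  fin_cases j
  · refine ⟨![1, 0], ?_⟩
    simp only [Fin.sum_univ_two, Matrix.cons_val_zero, Matrix.cons_val_one, Fin.zero_eta, ha]
    ring
  · refine ⟨![2 * s * X b + s ^ 2 * X a, 1], ?_⟩
    simp only [Fin.sum_univ_two, Matrix.cons_val_zero, Matrix.cons_val_one, Fin.mk_one, map_pow,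
      hb]
    ring

/-- **`σ(C) = C`** for the `J₃` datum (`map_centre_le` for `σ` with `s = 1` and for `σ⁻¹` with
`s = −1`). [folklore] -/
theorem map_centre_eq (k : Type) [Field k] (n : ℕ)
    (σ : MvPolynomial (Fin n) k ≃ₐ[k] MvPolynomial (Fin n) k) (a b : Fin n)
    (ha : σ (X a) = X a) (hb : σ (X b) = X b + X a) :
    Ideal.map (σ : MvPolynomial (Fin n) k →+* MvPolynomial (Fin n) k)
      (Ideal.span (Set.range (![X a, X b ^ 2] : Fin 2 → MvPolynomial (Fin n) k))) =
      Ideal.span (Set.range (![X a, X b ^ 2] : Fin 2 → MvPolynomial (Fin n) k)) := by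
  apply le_antisymm
  · exact map_centre_le k n a b (σ : MvPolynomial (Fin n) k →+* MvPolynomial (Fin n) k) 1
      (by simpa only [RingHom.coe_coe] using ha) (by simpa only [RingHom.coe_coe, one_mul] using hb)
  · have ha' : σ.symm (X a) = X a := by
      conv_lhs => rw [← ha]
      exact σ.symm_apply_apply _
    have hb' : σ.symm (X b) = X b + (-1) * X a := by
      have h := σ.symm_apply_apply (X b)
      rw [hb, map_add, ha'] at h
      linear_combination h
    have hle := map_centre_le k n a b (σ.symm : MvPolynomial (Fin n) k →+* MvPolynomial (Fin n) k)
      (-1) (by simpa only [RingHom.coe_coe] using ha') (by simpa only [RingHom.coe_coe] using hb')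
    have hcomp : (σ : MvPolynomial (Fin n) k →+* MvPolynomial (Fin n) k).comp
        (σ.symm : MvPolynomial (Fin n) k →+* MvPolynomial (Fin n) k) = RingHom.id _ := by
      ext x <;> simp
    calc Ideal.span (Set.range (![X a, X b ^ 2] : Fin 2 → MvPolynomial (Fin n) k))
        = Ideal.map ((σ : MvPolynomial (Fin n) k →+* MvPolynomial (Fin n) k).comp
            (σ.symm : MvPolynomial (Fin n) k →+* MvPolynomial (Fin n) k))
            (Ideal.span (Set.range (![X a, X b ^ 2] : Fin 2 → MvPolynomial (Fin n) k))) := by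
          rw [hcomp, Ideal.map_id]
      _ = Ideal.map (σ : MvPolynomial (Fin n) k →+* MvPolynomial (Fin n) k)
            (Ideal.map (σ.symm : MvPolynomial (Fin n) k →+* MvPolynomial (Fin n) k)
              (Ideal.span (Set.range (![X a, X b ^ 2] : Fin 2 → MvPolynomial (Fin n) k)))) := by
          rw [Ideal.map_map]
      _ ≤ _ := Ideal.map_mono hle

/-- **`C = (x_a, x_b²)` is `⟨σ⟩`-stable**: `g • C = C` for every `g ∈ ⟨σ⟩`, for the `J₃` datum
`σ x_b = x_b + x_a`, `σ x_i = x_i` (`i ≠ b, c`; so `σ x_a = x_a`), in EVERY characteristic — the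
hypothesis of `AffineQuotient.idealSheaf_comap_specAction`. [folklore] -/
theorem smul_centre_pointwise (k : Type) [Field k] (n : ℕ)
    (σ : MvPolynomial (Fin n) k ≃ₐ[k] MvPolynomial (Fin n) k) (a b c : Fin n)
    (hab : a ≠ b) (hac : a ≠ c) (hb : σ (X b) = X b + X a)
    (hσ : ∀ i, i ≠ b → i ≠ c → σ (X i) = X i) (g : Subgroup.zpowers σ) :
    g • Ideal.span (Set.range (![X a, X b ^ 2] : Fin 2 → MvPolynomial (Fin n) k)) =
      Ideal.span (Set.range (![X a, X b ^ 2] : Fin 2 → MvPolynomial (Fin n) k)) := by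
  have ha : σ (X a) = X a := hσ a hab hac
  have hσ' : σ • Ideal.span (Set.range (![X a, X b ^ 2] : Fin 2 → MvPolynomial (Fin n) k)) =
      Ideal.span (Set.range (![X a, X b ^ 2] : Fin 2 → MvPolynomial (Fin n) k)) :=
    map_centre_eq k n σ a b ha hb
  obtain ⟨z, hz⟩ := Subgroup.mem_zpowers_iff.mp g.2
  change (g : MvPolynomial (Fin n) k ≃ₐ[k] MvPolynomial (Fin n) k) •
      Ideal.span (Set.range (![X a, X b ^ 2] : Fin 2 → MvPolynomial (Fin n) k)) = _
  rw [← hz]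
  exact MulAction.fixedBy_subset_fixedBy_zpow (Ideal (MvPolynomial (Fin n) k)) σ z hσ'

/-- **The ideal sheaf of `C = (x_a, x_b²)` on `𝔸ⁿ` is stable under the action of `⟨σ⟩`**
(`ρ g = Spec (g⁻¹)`) — VERBATIM the hypothesis `hρ` of `IsBlowup.liftAction` for the V3U model
`Bl_C 𝔸ⁿ`, every characteristic. [folklore] -/
theorem idealSheaf_centre_comap (k : Type) [Field k] (n : ℕ)
    (σ : MvPolynomial (Fin n) k ≃ₐ[k] MvPolynomial (Fin n) k) (a b c : Fin n)
    (hab : a ≠ b) (hac : a ≠ c) (hb : σ (X b) = X b + X a)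
    (hσ : ∀ i, i ≠ b → i ≠ c → σ (X i) = X i)
    (ρ : ↥(Subgroup.zpowers σ) →* Aut (Spec (CommRingCat.of (MvPolynomial (Fin n) k))))
    (hρ : ∀ g : ↥(Subgroup.zpowers σ), (ρ g).hom = Spec.map (CommRingCat.ofHom
      ((MulSemiringAction.toRingEquiv (↥(Subgroup.zpowers σ)) (MvPolynomial (Fin n) k) g⁻¹ :
        MvPolynomial (Fin n) k ≃+* MvPolynomial (Fin n) k) :
          MvPolynomial (Fin n) k →+* MvPolynomial (Fin n) k)))
    (g : ↥(Subgroup.zpowers σ)) :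
    (affineBlowup.idealSheaf
      (Ideal.span (Set.range (![X a, X b ^ 2] : Fin 2 → MvPolynomial (Fin n) k)))).comap (ρ g).hom =
      affineBlowup.idealSheaf
        (Ideal.span (Set.range (![X a, X b ^ 2] : Fin 2 → MvPolynomial (Fin n) k))) :=
  AffineQuotient.idealSheaf_comap_specAction ρ hρ _ (smul_centre_pointwise k n σ a b c hab hac hb hσ) g

/-- **A2** (V5 verbatim): `d₁ = x_b² − x_a x_b − 2 x_a x_c` is `σ`-invariant (every characteristic).
[OURS · L1 W4.5c] [folklore] -/
theorem d1_invariant (k : Type) [Field k] (n : ℕ)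
    (σ : MvPolynomial (Fin n) k ≃ₐ[k] MvPolynomial (Fin n) k) (a b c : Fin n)
    (hab : a ≠ b) (hac : a ≠ c)
    (hb : σ (X b) = X b + X a) (hc : σ (X c) = X c + X b)
    (hσ : ∀ i, i ≠ b → i ≠ c → σ (X i) = X i) :
    σ (X b ^ 2 - X a * X b - 2 * (X a * X c)) = X b ^ 2 - X a * X b - 2 * (X a * X c) := by
  have ha : σ (X a) = X a := hσ a hab hac
  simp only [map_sub, map_mul, map_pow, map_ofNat, ha, hb, hc]
  ring

/-- **A3** (V5 verbatim): `(x_a, d₁) = (x_a, x_b²)` as ideals — the centre has the invariant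
generators `x_a, d₁`. [OURS · L1 W4.5c] [folklore] -/
theorem centre_span_eq (k : Type) [Field k] (n : ℕ) (a b c : Fin n) :
    Ideal.span ({X a, X b ^ 2 - X a * X b - 2 * (X a * X c)} : Set (MvPolynomial (Fin n) k)) =
      Ideal.span {X a, X b ^ 2} := by
  apply le_antisymm
  · rw [Ideal.span_le]
    rintro x (rfl | rfl)
    · exact Ideal.subset_span (Set.mem_insert _ _)
    · rw [SetLike.mem_coe, Ideal.mem_span_pair]
      exact ⟨-X b - 2 * X c, 1, by ring⟩
  · rw [Ideal.span_le]
    rintro x (rfl | rfl)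
    · exact Ideal.subset_span (Set.mem_insert _ _)
    · rw [SetLike.mem_coe, Ideal.mem_span_pair]
      exact ⟨X b + 2 * X c, 1, by ring⟩

/-- The generator vector `![x_a, x_b²]` spans `(x_a, x_b²)`. [folklore] -/
theorem span_range_centre_eq (k : Type) [Field k] (n : ℕ) (a b : Fin n) :
    Ideal.span (Set.range (![X a, X b ^ 2] : Fin 2 → MvPolynomial (Fin n) k)) =
      Ideal.span {(X a : MvPolynomial (Fin n) k), X b ^ 2} := by
  congr 1
  ext x
  simp only [Set.mem_range, Set.mem_insert_iff, Set.mem_singleton_iff]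
  constructor
  · rintro ⟨j, rfl⟩
    fin_cases j <;> simp
  · rintro (rfl | rfl)
    · exact ⟨0, rfl⟩
    · exact ⟨1, rfl⟩

/-- **A4 = V3U-B centre stability** (V5 verbatim; `Ideal.map` form of `smul_centre_pointwise`):
the centre `I₂ = (x_a, x_b²)` is stable under every `g ∈ ⟨σ⟩`, at EVERY characteristic.
[OURS · L1 W4.5c] [folklore] -/
theorem smul_centre_eq (k : Type) [Field k] (n : ℕ)
    (σ : MvPolynomial (Fin n) k ≃ₐ[k] MvPolynomial (Fin n) k) (a b c : Fin n)
    (hab : a ≠ b) (hac : a ≠ c)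
    (hb : σ (X b) = X b + X a) (hσ : ∀ i, i ≠ b → i ≠ c → σ (X i) = X i)
    (g : ↥(Subgroup.zpowers σ)) :
    Ideal.map ((g : MvPolynomial (Fin n) k ≃ₐ[k] MvPolynomial (Fin n) k) : _ →+* _)
        (Ideal.span (Set.range (![X a, X b ^ 2] : Fin 2 → MvPolynomial (Fin n) k))) =
      Ideal.span (Set.range (![X a, X b ^ 2] : Fin 2 → MvPolynomial (Fin n) k)) :=
  smul_centre_pointwise k n σ a b c hab hac hb hσ g

/-- **`Bl_{(x_a, x_b²)} 𝔸ⁿ` is integral, and `Bl → 𝔸ⁿ` is proper and birational** (`a ≠ b` not even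
needed: the centre is a non-zero ideal of a domain). It is NOT regular (chart `D₊(x_a t)` is the
`A₁`-cone). [cite: StacksProject, Tag 02OS] -/
theorem centre_blowup_integral_proper_birational (k : Type) [Field k] (n : ℕ) (a b : Fin n) :
    IsIntegral (affineBlowup
        (Ideal.span (Set.range (![X a, X b ^ 2] : Fin 2 → MvPolynomial (Fin n) k)))) ∧
      IsProper (affineBlowup.π
        (Ideal.span (Set.range (![X a, X b ^ 2] : Fin 2 → MvPolynomial (Fin n) k)))) ∧
      IsBirational (affineBlowup.π
        (Ideal.span (Set.range (![X a, X b ^ 2] : Fin 2 → MvPolynomial (Fin n) k)))) := by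
  have hne : Ideal.span (Set.range (![X a, X b ^ 2] : Fin 2 → MvPolynomial (Fin n) k)) ≠ ⊥ := by
    intro h
    have hx : (X a : MvPolynomial (Fin n) k) ∈
        Ideal.span (Set.range (![X a, X b ^ 2] : Fin 2 → MvPolynomial (Fin n) k)) :=
      Ideal.subset_span ⟨0, rfl⟩
    rw [h, Ideal.mem_bot] at hx
    exact X_ne_zero a hx
  exact ⟨affineBlowup.isIntegral hne, inferInstance, affineBlowup.isBirational hne⟩

/-- **The chart `D₊(x_b² t)` of `Bl_{(x_a, x_b²)} 𝔸ⁿ` is regular**: its ring is the polynomial ring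
`k[x_b, v, (x_s)_{s ≠ a,b}]`, `v = x_a/x_b²` (chart map `x_a ↦ x_a/x_b²`, `x_s ↦ x_s`, retracted by
`x_a ↦ x_a x_b²`; generic engine `isRegularRing_chartRing_of_chartData`). On it the lifted `σ` has
augmentation ideal `(x_b)` at its fixed points, at every `p` (K₃-chart B1 algebra). [folklore] -/
theorem isRegularRing_chartRing_centre_b (k : Type) [Field k] (n : ℕ) (a b : Fin n) (hab : a ≠ b) :
    IsRegularRing (chartRing (![X a, X b ^ 2] : Fin 2 → MvPolynomial (Fin n) k) 1) := by
  classical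
  set c : Fin 2 → MvPolynomial (Fin n) k := ![X a, X b ^ 2] with hc
  have hc0 : c 0 = X a := rfl
  have hc1 : c 1 = X b ^ 2 := rfl
  have hba : b ≠ a := fun h => hab h.symm
  set L := Localization.Away (c 1)
  set ι := algebraMap (MvPolynomial (Fin n) k) L with hιdef
  have hu : ι (c 1) * Away.invSelf (c 1) = 1 := Away.mul_invSelf (c 1)
  let Θ : MvPolynomial (Fin n) k →ₐ[k] L :=
    aeval fun s => if s = a then ι (c 0) * Away.invSelf (c 1) else ι (X s)
  let ω : MvPolynomial (Fin n) k →ₐ[k] MvPolynomial (Fin n) k :=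
    aeval fun s => if s = a then X a * X b ^ 2 else X s
  have hΘa : Θ (X a) = ι (c 0) * Away.invSelf (c 1) := by simp [Θ]
  have hΘs : ∀ s, s ≠ a → Θ (X s) = ι (X s) := fun s hs => by simp [Θ, hs]
  have hωa : ω (X a) = X a * X b ^ 2 := by simp [ω]
  have hωs : ∀ s, s ≠ a → ω (X s) = X s := fun s hs => by simp [ω, hs]
  have hωc1 : ω (c 1) = c 1 := by rw [hc1, map_pow, hωs b hba]
  have E := fun (A B : MvPolynomial (Fin n) k) (d d' : ℕ) (h : A * c 1 ^ d' = B * c 1 ^ d) =>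
    JordanThree.algebraMap_mul_invSelf_pow_eq (c 1) A B d d' h
  refine JordanThree.isRegularRing_chartRing_of_chartData c 1 ?_ Θ ω ?_ ?_ ?_ ?_ ?_
  · rw [hc1]; exact pow_ne_zero _ (X_ne_zero b)
  · intro s
    by_cases hs : s = a
    · subst hs
      rw [hωa, map_mul, map_pow, hΘa, hΘs b hba]
      have key := E (c 0 * X b ^ 2) (X s) 1 0 (by rw [hc0, hc1]; ring)
      rw [pow_one, pow_zero, mul_one, map_mul, map_pow] at key
      rw [← key]
      ring
    · rw [hωs s hs, hΘs s hs]
  · intro s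
    by_cases hs : s = a
    · subst hs
      rw [hΘa]
      exact div_mem_blowupAlgebra _ _ (Ideal.mem_span_range_self (f := c) (x := 0))
    · rw [hΘs s hs]
      exact Subalgebra.algebraMap_mem _ _
  · intro j
    fin_cases j
    · exact ⟨X a, hΘa⟩
    · refine ⟨1, ?_⟩
      change Θ 1 = ι (c 1) * _
      rw [map_one, hu]
  · exact ⟨1, 1, by rw [hωc1, mul_one, pow_one]⟩
  · intro s
    by_cases hs : s = a
    · subst hs
      refine ⟨c 0, 1, by rw [hΘa, pow_one], ?_⟩
      rw [pow_one, hωc1, hc0, hc1, hωa]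
    · exact ⟨X s, 0, by rw [hΘs s hs, pow_zero, mul_one], by rw [pow_zero, mul_one, hωs s hs]⟩

end Summit.ResolutionOfSingularities.ResolutionOfSingularities.Theorems.WildQuotientResolution.ToricExit

end
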